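import Summits.QuantumFields.BalabanUV.Beta.GAN24.T2DriftEvenEnd
import Summits.QuantumFields.BalabanUV.Beta.GAN24.T2ShapeEvenEndRows

/-!
# `BalabanUV.Beta.GAN24.T2DriftEvenEndRows` — binder row G-an2-4 ∕ (CONV-C), W-slot EXIT (α) (RULING R-lead-g77-1 (2); the OWNER's RULING R-gan24p1-g33-1 + A1,
# piece (α-END-c′) PART 2): **«T2Drift^{ε}» OF THE PARITY `ε`-MEMBER FROM THE COMB FAMILY's S-SLOT ROWS, THE BORDER ROWS AND THREE DISPLAYED ROWS `hcell` ∧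
# `hcelld` ∧ `hC`; the JOINT PAIR («T2Shape^{ev}», «T2Drift^{ev}») at one rate in the consumer's spelling** (row owner `b2b-balaban-gan24-p1`, gen 34)

NOT IN PRINT; OUR BOOKKEEPING ([folklore] composition BY NAME; 0 `def`, 0 cited facts, 0 `def … : Prop`, 0 sorry).  HONEST FRAMING (cell contract, verbatim):
«discharging `BetaPertH` makes Bałaban's UV stability UNCONDITIONAL — a real constructive-QFT result; it is NOT the continuum limit and NOT the Clay problem.»
HONEST DEPENDENCY (verbatim): «continuum YM on T⁴ ⇐ BetaPertH ∧ nine spine estimates (0/9 proved); BetaPertH ⇐ (D1) ∧ (D4) ∧ CAP+tail; G-an2-4 gates asym, D1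
and NE2/3/4.»

WHAT (objects as in PART 1 `GAN24/T2DriftEvenEnd` and the shape END `GAN24/T2ShapeEvenEnd{,Rows}`; `d = 3`, `2 ≤ Lc`, in-block root `r`, EXACT pin `cE₂ = +Lc⁸`, `|ε| ≤ 1`,
jointly covariant off-diagonal `LocStencil₂` border `hBff hBmm hB hδB hBt`; `cell^{ε}_l := 𝒜^Ĝ_l y_l − 𝒜^K_l y_l`).
* §0 (generic `d`) `locStencil₂_halfTable_sub` (halves of a difference, `biLoc_half` slotwise), `locStencil₂_sub_add_sub` (`abel` ⨾ `locStencil₂_add`).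
* §1 **`rate_halfMember_three_of_rows`** — PART 1's socket `rate_halfMember_three_of_relSource_rows` with: «T2Shape^{ε}» `hy` := MY shape END
  `T2ShapeEvenEndRows.locStencil₂_halfMember_three_of_rows` (same displayed rows `hcell` ∧ `hC`); the relative source's shape `hb` := p2 g35's (F4a)
  `T2RecSourceRows.source_rows_three_of_srecAt_rows`.1 ⨾ `locStencil₂_halfTable` + `hcell`; its covariance half of `hZ` := `T2DevCovariance` ∕ `lin4_dressed_translate` ∕
  `lin4_translate` ⨾ `translate_halfTable` (as the shape PART 2), its charge half := `hC` (displayed); its DRIFT `hbd` := (F4b) `source_rows_three_of_srecAt_rows`.2 at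
  `(l, 1)` ⨾ §0 + the cells' drift `hcelld` (displayed), the two geometric rates merged at `max θb θc` (leaf-07's `locStencil₂_le_mono` ∕ `mul_pow_le_mul_pow`).
  DISPLAYED: `hcell : ∀ l, LocStencil₂ (cell^{ε}_l) Ccl δcl` ((α-END-b); leaf-03 g66's FILEs 1–3a give it from four letter rows), **`hcelld : ∀ l, LocStencil₂ (cell^{ε}_{l+1} −
  cell^{ε}_l) (Ccd·θc^l) δcd`** ((α-END-b′), NEW — the cells' one-step DRIFT; located recipe in the OWNER's journal ASK A-g34-1: K-Cauchy × the letter rows + the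
  letters' drift rows), `hC` ((C)^{ε}: `ZfreeSym` of the relative source; leaf-01 g72's `RelSourceHalf` ⨾ MY `ZeroModeParity.zsym_halfTable` give it from row (C) of
  record) ⟹ «T2Drift^{ε}» (one-step rate ∧ Cauchy form).  **`t2DriftEven_three_of_rows`** — `ε = 1` without the unit scalar (`one_smul`).
* §2 **`exists_hT₂_hT₂d_even_three_of_rows`** — THE JOINT PAIR at ONE rate: `∃ C₂ c₂ θ₂ δ₂, 0 < δ₂ ∧ 0 ≤ θ₂ ∧ θ₂ < 1 ∧ (∀ j, LocStencil₂ (y_j) C₂ δ₂) ∧ (∀ k j,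
  LocStencil₂ (y_{k+j} − y_k) (c₂·θ₂^k) δ₂)` for the EVEN member `y_j = ½ • (T̃_j + P T̃_j)` — the binders `hT₂ ∕ hT₂d` of p2 g45's
  `WrecAtEvenHalfRowsFinal.hW_hWall_evenHalf_WrecAt_three_of_T2ev` ∕ `exists_allScalesSeq_JsRowD1Pin_of_T2ev` TOKEN FOR TOKEN (`min` of the two ENDs' rates).
CHAIN ((α-0)): S-slot rows (TREE) ∧ `hcell` ∧ `hcelld` ∧ `hC` ⟹ [§2] (`hT₂`, `hT₂d`)^{ev} ⟹ [p2 g45] (hW, hWall)^{ev} ⟹ [leaf-01 `WSlotParityJunction`] ⟹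
[MY `WSlotParityBlind`] the D1 literal's `hall`.  CONDITIONAL on `hcell` ∧ `hcelld` ∧ `hC` (+ exact pin, border rows); asserts NO shape of Bałaban's tables beyond those
rows, NO value of any charge; NOTHING of (hW, hWall) ∕ (C) ∕ (Q-L) discharged; (β) untouched; NEVER «G-an2-4 closed» as (CONV-C); NOT D1, NOT `BetaPertH`, NOT continuum,
NOT Clay.  2026-08-23.
-/

noncomputable section

open Finset
open scoped BigOperators
open Literature.MathematicalPhysics.QuantumFieldTheory
open Literature.MathematicalPhysics.QuantumFieldTheory.Balaban1983to89
open Literature.MathematicalPhysics.QuantumFieldTheory.Balaban1983to89.Beta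
open ExpKernelCalculus (MKer BiLoc shiftK)
open OneStepResolventKernel (Fib LocStencil)
open OneStepKernelFamily (KInvStep)
open AffineAveraging (box toSite)
open AveragingMixedJetTables (mixFFAt)
open SecondOrderResponse (W2SymOfK)
open BalabanCompositeJets (LocStencil₂ LocStencil₂.nonneg LocStencil₂.mono)
open BalabanStepJetsSucc (mmRead)
open BalabanStepW2 (K3OfK M2Of)
open Summit.QuantumFields.BalabanUV.Beta.TameKernelCalculus (trK trK_apply)
open Summit.QuantumFields.BalabanUV.Beta.BorderedHessian (sgnK sgnK_apply)
open Summit.QuantumFields.BalabanUV.Beta.HessKerDressedUnits (unitK unitS)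
open Summit.QuantumFields.BalabanUV.Beta.SecondOrderUnits (unitM unitS₂ unitM₂)
open Summit.QuantumFields.BalabanUV.Beta.AxialDressingRooted (coDressKBmAt)
open Summit.QuantumFields.BalabanUV.Beta.SpineRooted (T2RecAt SpureRecAt M1At)
open Summit.QuantumFields.BalabanUV.Beta.WardLocusRecursive (SrecAt)
open Summit.QuantumFields.BalabanUV.Beta.GAN24.CombesThomas (sfStep smStep)
open Summit.QuantumFields.BalabanUV.Beta.GAN24.T2RecursionAffine (lin4)
open Summit.QuantumFields.BalabanUV.Beta.GAN24.BiStencilZeroMode (zmode)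
open Summit.QuantumFields.BalabanUV.Beta.GAN24.WSlotT2OfPieces (locStencil₂_add)
open Summit.QuantumFields.BalabanUV.Beta.GAN24.WSlotCauchyOfShapes (locStencil₂_le_mono mul_pow_le_mul_pow)
open Summit.QuantumFields.BalabanUV.Beta.GAN24.WSlotForcingZeroModeW3 (add_translate_pi sub_translate_pi)
open Summit.QuantumFields.BalabanUV.Beta.GAN24.Lin4ZeroMode (lin4_translate shiftK_unitKInvStep)
open Summit.QuantumFields.BalabanUV.Beta.GAN24.DressedStepCharge (lin4_dressed_translate)
open Summit.QuantumFields.BalabanUV.Beta.GAN24.T2DevCovariance (unitS₂_T2RecAt_translate source_comb_dressed_translate)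
open Summit.QuantumFields.BalabanUV.Beta.GAN24.T2RecSourceRows (source_rows_three_of_srecAt_rows)
open Summit.QuantumFields.BalabanUV.Beta.GAN24.BiTableParityHalves (biLoc_half)
open Summit.QuantumFields.BalabanUV.Beta.GAN24.T2ShapeEvenEnd (locStencil₂_halfTable translate_halfTable)
open Summit.QuantumFields.BalabanUV.Beta.GAN24.T2ShapeEvenEndRows (locStencil₂_halfMember_three_of_rows t2ShapeEven_three_of_rows)
open Summit.QuantumFields.BalabanUV.Beta.GAN24.T2DriftEvenEnd (rate_halfMember_three_of_relSource_rows)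

namespace Summit.QuantumFields.BalabanUV.Beta.GAN24.T2DriftEvenEndRows

/-! ## §0 Generic `d`: two table lemmas -/

section Generic
variable {d : ℕ}

/-- [folklore] **THE `ε`-HALVES OF TWO TABLES DIFFER BY THE `ε`-HALF OF THEIR DIFFERENCE** (`|ε| ≤ 1`; `sgnK ∘ trK` is linear slotwise, then the OWNER's `biLoc_half`): a
`LocStencil₂` row of the lambda-spelled difference `fun κ u κ′ u′ ↦ X κ u κ′ u′ − Y κ u κ′ u′` gives the same row for `½ • (X + ε • P X) − ½ • (Y + ε • P Y)`. -/
theorem locStencil₂_halfTable_sub {X Y : Fin (d + 1) → (Fin (d + 1) → ℤ) → Fin (d + 1) → (Fin (d + 1) → ℤ) → MKer (d + 1) (Fib d)} {C δ : ℝ}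
    (h : LocStencil₂ (fun κ u κ' u' => X κ u κ' u' - Y κ u κ' u') C δ) {ε : ℝ} (hε : |ε| ≤ 1) :
    LocStencil₂ (((1 : ℝ) / 2) • (X + ε • fun κ u κ' u' => sgnK (trK (X κ u κ' u'))) -
      ((1 : ℝ) / 2) • (Y + ε • fun κ u κ' u' => sgnK (trK (Y κ u κ' u')))) C δ := by
  intro κ u κ' u'
  have e : (((1 : ℝ) / 2) • (X + ε • fun κ u κ' u' => sgnK (trK (X κ u κ' u'))) -
        ((1 : ℝ) / 2) • (Y + ε • fun κ u κ' u' => sgnK (trK (Y κ u κ' u')))) κ u κ' u' =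
      ((1 : ℝ) / 2) • ((X κ u κ' u' - Y κ u κ' u') + ε • sgnK (trK (X κ u κ' u' - Y κ u κ' u'))) := by
    funext x z a b
    simp only [Pi.sub_apply, Pi.add_apply, Pi.smul_apply, smul_eq_mul, sgnK_apply, trK_apply]
    ring
  rw [e]
  exact biLoc_half (h κ u κ' u') hε

/-- [folklore] `(A + B) − (A′ + B′) = (A − A′) + (B − B′)` under `LocStencil₂` (common rate; `abel` ⨾ the OWNER's `locStencil₂_add`). -/
theorem locStencil₂_sub_add_sub {A B A' B' : Fin (d + 1) → (Fin (d + 1) → ℤ) → Fin (d + 1) → (Fin (d + 1) → ℤ) → MKer (d + 1) (Fib d)} {C₁ C₂ δ : ℝ}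
    (h₁ : LocStencil₂ (A - A') C₁ δ) (h₂ : LocStencil₂ (B - B') C₂ δ) : LocStencil₂ ((A + B) - (A' + B')) (C₁ + C₂) δ := by
  have e : (A + B) - (A' + B') = (A - A') + (B - B') := by abel
  rw [e]
  exact locStencil₂_add h₁ h₂

end Generic

/-! ## §1 `d = 3`: «T2Drift^{ε}» from the S-slot rows, the border rows and `hcell` ∧ `hcelld` ∧ `hC` -/

section Three
variable {Lc : ℕ} [NeZero Lc] {r : Fin (3 + 1) → ℕ}

/-- NOT IN PRINT; OUR BOOKKEEPING ([folklore] composition BY NAME — see the module docstring for every slot).  **«T2Drift^{ε}» OF THE `ε`-MEMBER FROM THE COMB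
FAMILY's S-SLOT ROWS, THE BORDER ROWS, AND THREE DISPLAYED ROWS `hcell` ∧ `hcelld` ∧ `hC`** (`d = 3`, `2 ≤ Lc`, in-block root, EXACT pin `cE₂ = +Lc⁸`, `|ε| ≤ 1`):
PART 1's socket with «T2Shape^{ε}» by MY shape END, the relative source's shape ∕ covariance ∕ source-drift halves discharged BY NAME (p2 g35's (F4a)∕(F4b),
`T2DevCovariance`, shape PART 1 §1, §0), the two drift rates merged at `max θb θc`.  DISPLAYED: `hcell` ((α-END-b)), `hcelld` ((α-END-b′): the cells' one-step
DRIFT, NEW), `hC` ((C)^{ε}). -/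
theorem rate_halfMember_three_of_rows (hLc : 2 ≤ Lc) (hr : r ∈ box (3 + 1) Lc) (cE cVH cΛ cE₂ cB : ℝ)
    (hpinEq : cE₂ = (Lc : ℝ) ^ (2 * (3 + 1))) (Tc : Fin 4 → Fin 4 → Fin 4 → Fin 4 → ℝ)
    {vh₂S : Fin (3 + 1) → (Fin (3 + 1) → ℤ) → Fin (3 + 1) → (Fin (3 + 1) → ℤ) → MKer (3 + 1) (Fib 3)}
    (hBff : ∀ κ u κ' u' x z (α β : Fin (3 + 1)), vh₂S κ u κ' u' x z (Sum.inl α) (Sum.inl β) = 0)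
    (hBmm : ∀ κ u κ' u' x z (μ ν : Fin (3 + 1)), vh₂S κ u κ' u' x z (Sum.inr μ) (Sum.inr ν) = 0)
    {CB δB : ℝ} (hB : LocStencil₂ vh₂S CB δB) (hδB : 0 < δB)
    (hBt : ∀ (κ : Fin (3 + 1)) (u : Fin (3 + 1) → ℤ) (κ' : Fin (3 + 1)) (u' t : Fin (3 + 1) → ℤ),
        vh₂S κ (u + (Lc : ℤ) • t) κ' (u' + (Lc : ℤ) • t) = shiftK (-((Lc : ℤ) • t)) (vh₂S κ u κ' u'))
    {Cs cS θS δS : ℝ} (hS : ∀ j, LocStencil (unitS (sfStep Lc j) (smStep 3 Lc j) (SrecAt 3 Lc (toSite r) cE cVH cΛ j)) Cs δS)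
    (hSall : ∀ k j, LocStencil (unitS (sfStep Lc (k + j)) (smStep 3 Lc (k + j)) (SrecAt 3 Lc (toSite r) cE cVH cΛ (k + j)) -
      unitS (sfStep Lc k) (smStep 3 Lc k) (SrecAt 3 Lc (toSite r) cE cVH cΛ k)) (cS * θS ^ k) δS)
    (hδS : 0 < δS) (hθS0 : 0 ≤ θS) (hθS1 : θS < 1)
    (ε : ℝ) (hε : |ε| ≤ 1)
    {Ccl δcl : ℝ}
    (hcell : ∀ l, LocStencil₂
      (lin4 (cE₂ * (Lc : ℝ) ^ (2 * (3 + 1))) (unitK (sfStep Lc l) (smStep 3 Lc l) (coDressKBmAt (toSite r) Lc (KInvStep (d := 3) Lc l))) Lc (((1 : ℝ) / 2) • (unitS₂ (sfStep Lc l) (smStep 3 Lc l)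
        (T2RecAt 3 Lc (toSite r) cE cVH cΛ cE₂ cB Tc vh₂S (mixFFAt (toSite r) Lc) l) + ε • fun κ u κ' u' => sgnK (trK ((unitS₂ (sfStep Lc l) (smStep 3 Lc l) (T2RecAt 3 Lc (toSite r) cE cVH cΛ
        cE₂ cB Tc vh₂S (mixFFAt (toSite r) Lc) l)) κ u κ' u')))) - lin4 (cE₂ * (Lc : ℝ) ^ (2 * (3 + 1))) (unitK (sfStep Lc l) (smStep 3 Lc l) (KInvStep (d := 3) Lc l)) Lc (((1 : ℝ) / 2) •
        (unitS₂ (sfStep Lc l) (smStep 3 Lc l) (T2RecAt 3 Lc (toSite r) cE cVH cΛ cE₂ cB Tc vh₂S (mixFFAt (toSite r) Lc) l) + ε • fun κ u κ' u' => sgnK (trK ((unitS₂ (sfStep Lc l) (smStep 3 Lc l)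
        (T2RecAt 3 Lc (toSite r) cE cVH cΛ cE₂ cB Tc vh₂S (mixFFAt (toSite r) Lc) l)) κ u κ' u'))))) Ccl δcl)
    (hδcl : 0 < δcl) {Ccd θc δcd : ℝ}
    (hcelld : ∀ l, LocStencil₂
      ((lin4 (cE₂ * (Lc : ℝ) ^ (2 * (3 + 1))) (unitK (sfStep Lc (l + 1)) (smStep 3 Lc (l + 1)) (coDressKBmAt (toSite r) Lc (KInvStep (d := 3) Lc (l + 1)))) Lc (((1 : ℝ) / 2) • (unitS₂ (sfStep Lc (l +
        1)) (smStep 3 Lc (l + 1)) (T2RecAt 3 Lc (toSite r) cE cVH cΛ cE₂ cB Tc vh₂S (mixFFAt (toSite r) Lc) (l + 1)) + ε • fun κ u κ' u' => sgnK (trK ((unitS₂ (sfStep Lc (l + 1)) (smStep 3 Lc (l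
        + 1)) (T2RecAt 3 Lc (toSite r) cE cVH cΛ cE₂ cB Tc vh₂S (mixFFAt (toSite r) Lc) (l + 1))) κ u κ' u')))) - lin4 (cE₂ * (Lc : ℝ) ^ (2 * (3 + 1))) (unitK (sfStep Lc (l + 1)) (smStep 3 Lc (l
        + 1)) (KInvStep (d := 3) Lc (l + 1))) Lc (((1 : ℝ) / 2) • (unitS₂ (sfStep Lc (l + 1)) (smStep 3 Lc (l + 1)) (T2RecAt 3 Lc (toSite r) cE cVH cΛ cE₂ cB Tc vh₂S (mixFFAt (toSite r) Lc) (l +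
        1)) + ε • fun κ u κ' u' => sgnK (trK ((unitS₂ (sfStep Lc (l + 1)) (smStep 3 Lc (l + 1)) (T2RecAt 3 Lc (toSite r) cE cVH cΛ cE₂ cB Tc vh₂S (mixFFAt (toSite r) Lc) (l + 1))) κ u κ' u'))))) -
       (lin4 (cE₂ * (Lc : ℝ) ^ (2 * (3 + 1))) (unitK (sfStep Lc l) (smStep 3 Lc l) (coDressKBmAt (toSite r) Lc (KInvStep (d := 3) Lc l))) Lc (((1 : ℝ) / 2) • (unitS₂ (sfStep Lc l) (smStep 3 Lc l)
        (T2RecAt 3 Lc (toSite r) cE cVH cΛ cE₂ cB Tc vh₂S (mixFFAt (toSite r) Lc) l) + ε • fun κ u κ' u' => sgnK (trK ((unitS₂ (sfStep Lc l) (smStep 3 Lc l) (T2RecAt 3 Lc (toSite r) cE cVH cΛ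
        cE₂ cB Tc vh₂S (mixFFAt (toSite r) Lc) l)) κ u κ' u')))) - lin4 (cE₂ * (Lc : ℝ) ^ (2 * (3 + 1))) (unitK (sfStep Lc l) (smStep 3 Lc l) (KInvStep (d := 3) Lc l)) Lc (((1 : ℝ) / 2) •
        (unitS₂ (sfStep Lc l) (smStep 3 Lc l) (T2RecAt 3 Lc (toSite r) cE cVH cΛ cE₂ cB Tc vh₂S (mixFFAt (toSite r) Lc) l) + ε • fun κ u κ' u' => sgnK (trK ((unitS₂ (sfStep Lc l) (smStep 3 Lc l)
        (T2RecAt 3 Lc (toSite r) cE cVH cΛ cE₂ cB Tc vh₂S (mixFFAt (toSite r) Lc) l)) κ u κ' u')))))) (Ccd * θc ^ l) δcd)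
    (hθc0 : 0 ≤ θc) (hθc1 : θc < 1) (hδcd : 0 < δcd)
    (hC : ∀ l, (∀ κ κ' κ₁ κ₂, zmode Lc (((1 : ℝ) / 2) • ((fun κ u κ' u' => (cE₂ * (Lc : ℝ) ^ (2 * (3 + 1))) • mmRead Lc (K3OfK (unitK (sfStep Lc l) (smStep 3 Lc l) (coDressKBmAt (toSite r) Lc (KInvStep (d :=
        3) Lc l))) Lc (unitS (sfStep Lc l) (smStep 3 Lc l) (SpureRecAt 3 Lc (toSite r) cE cVH cΛ l)) (unitM (sfStep Lc l) (smStep 3 Lc l) (M1At 3 Lc (toSite r) cΛ l)) (W2SymOfK (unitK (sfStep Lc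
        l) (smStep 3 Lc l) (coDressKBmAt (toSite r) Lc (KInvStep (d := 3) Lc l))) Lc (unitS (sfStep Lc l) (smStep 3 Lc l) (SpureRecAt 3 Lc (toSite r) cE cVH cΛ l)) (unitM (sfStep Lc l) (smStep 3
        Lc l) (M1At 3 Lc (toSite r) cΛ l)) 0 (unitM₂ (sfStep Lc l) (smStep 3 Lc l) (M2Of 3 Lc (mixFFAt (toSite r) Lc) l))) κ u κ' u') + cB • vh₂S κ u κ' u') + ε • fun κ u κ' u' => sgnK (trK
        ((cE₂ * (Lc : ℝ) ^ (2 * (3 + 1))) • mmRead Lc (K3OfK (unitK (sfStep Lc l) (smStep 3 Lc l) (coDressKBmAt (toSite r) Lc (KInvStep (d := 3) Lc l))) Lc (unitS (sfStep Lc l) (smStep 3 Lc l)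
        (SpureRecAt 3 Lc (toSite r) cE cVH cΛ l)) (unitM (sfStep Lc l) (smStep 3 Lc l) (M1At 3 Lc (toSite r) cΛ l)) (W2SymOfK (unitK (sfStep Lc l) (smStep 3 Lc l) (coDressKBmAt (toSite r) Lc
        (KInvStep (d := 3) Lc l))) Lc (unitS (sfStep Lc l) (smStep 3 Lc l) (SpureRecAt 3 Lc (toSite r) cE cVH cΛ l)) (unitM (sfStep Lc l) (smStep 3 Lc l) (M1At 3 Lc (toSite r) cΛ l)) 0 (unitM₂
        (sfStep Lc l) (smStep 3 Lc l) (M2Of 3 Lc (mixFFAt (toSite r) Lc) l))) κ u κ' u') + cB • vh₂S κ u κ' u'))) + (lin4 (cE₂ * (Lc : ℝ) ^ (2 * (3 + 1))) (unitK (sfStep Lc l) (smStep 3 Lc l)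
        (coDressKBmAt (toSite r) Lc (KInvStep (d := 3) Lc l))) Lc (((1 : ℝ) / 2) • (unitS₂ (sfStep Lc l) (smStep 3 Lc l) (T2RecAt 3 Lc (toSite r) cE cVH cΛ cE₂ cB Tc vh₂S (mixFFAt (toSite r) Lc)
        l) + ε • fun κ u κ' u' => sgnK (trK ((unitS₂ (sfStep Lc l) (smStep 3 Lc l) (T2RecAt 3 Lc (toSite r) cE cVH cΛ cE₂ cB Tc vh₂S (mixFFAt (toSite r) Lc) l)) κ u κ' u')))) - lin4 (cE₂ * (Lc :
        ℝ) ^ (2 * (3 + 1))) (unitK (sfStep Lc l) (smStep 3 Lc l) (KInvStep (d := 3) Lc l)) Lc (((1 : ℝ) / 2) • (unitS₂ (sfStep Lc l) (smStep 3 Lc l) (T2RecAt 3 Lc (toSite r) cE cVH cΛ cE₂ cB Tc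
        vh₂S (mixFFAt (toSite r) Lc) l) + ε • fun κ u κ' u' => sgnK (trK ((unitS₂ (sfStep Lc l) (smStep 3 Lc l) (T2RecAt 3 Lc (toSite r) cE cVH cΛ cE₂ cB Tc vh₂S (mixFFAt (toSite r) Lc) l)) κ u
        κ' u')))))) κ κ' (Sum.inl κ₁) (Sum.inl κ₂) + zmode Lc (((1 : ℝ) / 2) • ((fun κ u κ' u' => (cE₂ * (Lc : ℝ) ^ (2 * (3 + 1))) • mmRead Lc (K3OfK (unitK (sfStep Lc l) (smStep 3 Lc l)
        (coDressKBmAt (toSite r) Lc (KInvStep (d := 3) Lc l))) Lc (unitS (sfStep Lc l) (smStep 3 Lc l) (SpureRecAt 3 Lc (toSite r) cE cVH cΛ l)) (unitM (sfStep Lc l) (smStep 3 Lc l) (M1At 3 Lc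
        (toSite r) cΛ l)) (W2SymOfK (unitK (sfStep Lc l) (smStep 3 Lc l) (coDressKBmAt (toSite r) Lc (KInvStep (d := 3) Lc l))) Lc (unitS (sfStep Lc l) (smStep 3 Lc l) (SpureRecAt 3 Lc (toSite
        r) cE cVH cΛ l)) (unitM (sfStep Lc l) (smStep 3 Lc l) (M1At 3 Lc (toSite r) cΛ l)) 0 (unitM₂ (sfStep Lc l) (smStep 3 Lc l) (M2Of 3 Lc (mixFFAt (toSite r) Lc) l))) κ u κ' u') + cB • vh₂S
        κ u κ' u') + ε • fun κ u κ' u' => sgnK (trK ((cE₂ * (Lc : ℝ) ^ (2 * (3 + 1))) • mmRead Lc (K3OfK (unitK (sfStep Lc l) (smStep 3 Lc l) (coDressKBmAt (toSite r) Lc (KInvStep (d := 3) Lc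
        l))) Lc (unitS (sfStep Lc l) (smStep 3 Lc l) (SpureRecAt 3 Lc (toSite r) cE cVH cΛ l)) (unitM (sfStep Lc l) (smStep 3 Lc l) (M1At 3 Lc (toSite r) cΛ l)) (W2SymOfK (unitK (sfStep Lc l)
        (smStep 3 Lc l) (coDressKBmAt (toSite r) Lc (KInvStep (d := 3) Lc l))) Lc (unitS (sfStep Lc l) (smStep 3 Lc l) (SpureRecAt 3 Lc (toSite r) cE cVH cΛ l)) (unitM (sfStep Lc l) (smStep 3 Lc
        l) (M1At 3 Lc (toSite r) cΛ l)) 0 (unitM₂ (sfStep Lc l) (smStep 3 Lc l) (M2Of 3 Lc (mixFFAt (toSite r) Lc) l))) κ u κ' u') + cB • vh₂S κ u κ' u'))) + (lin4 (cE₂ * (Lc : ℝ) ^ (2 * (3 +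
        1))) (unitK (sfStep Lc l) (smStep 3 Lc l) (coDressKBmAt (toSite r) Lc (KInvStep (d := 3) Lc l))) Lc (((1 : ℝ) / 2) • (unitS₂ (sfStep Lc l) (smStep 3 Lc l) (T2RecAt 3 Lc (toSite r) cE cVH
        cΛ cE₂ cB Tc vh₂S (mixFFAt (toSite r) Lc) l) + ε • fun κ u κ' u' => sgnK (trK ((unitS₂ (sfStep Lc l) (smStep 3 Lc l) (T2RecAt 3 Lc (toSite r) cE cVH cΛ cE₂ cB Tc vh₂S (mixFFAt (toSite r)
        Lc) l)) κ u κ' u')))) - lin4 (cE₂ * (Lc : ℝ) ^ (2 * (3 + 1))) (unitK (sfStep Lc l) (smStep 3 Lc l) (KInvStep (d := 3) Lc l)) Lc (((1 : ℝ) / 2) • (unitS₂ (sfStep Lc l) (smStep 3 Lc l)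
        (T2RecAt 3 Lc (toSite r) cE cVH cΛ cE₂ cB Tc vh₂S (mixFFAt (toSite r) Lc) l) + ε • fun κ u κ' u' => sgnK (trK ((unitS₂ (sfStep Lc l) (smStep 3 Lc l) (T2RecAt 3 Lc (toSite r) cE cVH cΛ
        cE₂ cB Tc vh₂S (mixFFAt (toSite r) Lc) l)) κ u κ' u')))))) κ' κ (Sum.inl κ₁) (Sum.inl κ₂) = 0)) :
    ∃ c ϑ δ : ℝ, 0 ≤ c ∧ 0 < ϑ ∧ ϑ < 1 ∧ 0 < δ ∧
      (∀ n, LocStencil₂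
        ((((1 : ℝ) / 2) • (unitS₂ (sfStep Lc (n + 1)) (smStep 3 Lc (n + 1)) (T2RecAt 3 Lc (toSite r) cE cVH cΛ cE₂ cB Tc vh₂S (mixFFAt (toSite r) Lc) (n + 1)) + ε • fun κ u κ' u' => sgnK (trK ((unitS₂
          (sfStep Lc (n + 1)) (smStep 3 Lc (n + 1)) (T2RecAt 3 Lc (toSite r) cE cVH cΛ cE₂ cB Tc vh₂S (mixFFAt (toSite r) Lc) (n + 1))) κ u κ' u')))) -
         (((1 : ℝ) / 2) • (unitS₂ (sfStep Lc n) (smStep 3 Lc n) (T2RecAt 3 Lc (toSite r) cE cVH cΛ cE₂ cB Tc vh₂S (mixFFAt (toSite r) Lc) n) + ε • fun κ u κ' u' => sgnK (trK ((unitS₂ (sfStep Lc n)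
          (smStep 3 Lc n) (T2RecAt 3 Lc (toSite r) cE cVH cΛ cE₂ cB Tc vh₂S (mixFFAt (toSite r) Lc) n)) κ u κ' u'))))) (c * ϑ ^ n) δ) ∧
      (∀ k j, LocStencil₂
        ((((1 : ℝ) / 2) • (unitS₂ (sfStep Lc (k + j)) (smStep 3 Lc (k + j)) (T2RecAt 3 Lc (toSite r) cE cVH cΛ cE₂ cB Tc vh₂S (mixFFAt (toSite r) Lc) (k + j)) + ε • fun κ u κ' u' => sgnK (trK ((unitS₂
          (sfStep Lc (k + j)) (smStep 3 Lc (k + j)) (T2RecAt 3 Lc (toSite r) cE cVH cΛ cE₂ cB Tc vh₂S (mixFFAt (toSite r) Lc) (k + j))) κ u κ' u')))) -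
         (((1 : ℝ) / 2) • (unitS₂ (sfStep Lc k) (smStep 3 Lc k) (T2RecAt 3 Lc (toSite r) cE cVH cΛ cE₂ cB Tc vh₂S (mixFFAt (toSite r) Lc) k) + ε • fun κ u κ' u' => sgnK (trK ((unitS₂ (sfStep Lc k)
          (smStep 3 Lc k) (T2RecAt 3 Lc (toSite r) cE cVH cΛ cE₂ cB Tc vh₂S (mixFFAt (toSite r) Lc) k)) κ u κ' u'))))) (c * (1 - ϑ)⁻¹ * ϑ ^ k) δ) := by
  have hLc1 : 1 ≤ Lc := le_trans (by norm_num) hLc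
  have hpin : |cE₂| ≤ (Lc : ℝ) ^ (2 * (3 + 1)) := by
    rw [hpinEq, abs_of_nonneg (by positivity)]
  -- (F4a) ∧ (F4b): the dressed source's shape AND Cauchy rows from the S-slot rows alone (p2 g35)
  obtain ⟨⟨Cb, δb, hδb, hbt⟩, ⟨cb, θb, δb', hcb, hθb0, hθb1, hδb', hbdS⟩⟩ :=
    source_rows_three_of_srecAt_rows hLc hr cE cVH cΛ cE₂ cB hB hδB hS hSall hδS hθS0 hθS1
  -- «T2Shape^ε» by the shape END (same displayed rows `hcell`, `hC`)
  obtain ⟨Cy, δy, hδy, hy⟩ := locStencil₂_halfMember_three_of_rows hLc hr cE cVH cΛ cE₂ cB hpin Tc hBff hBmm hB hδB hBt hS hSall hδS hθS0 hθS1 ε hε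
    hcell hδcl hC
  have hm : 0 < min δb δcl := lt_min hδb hδcl
  -- the member's joint covariance (`T2DevCovariance` ⨾ shape PART 1 §1)
  have hY := fun (l : ℕ) (κ : Fin (3 + 1)) (u : Fin (3 + 1) → ℤ) (κ' : Fin (3 + 1)) (u' t : Fin (3 + 1) → ℤ) =>
    translate_halfTable (fun κ u κ' u' t => unitS₂_T2RecAt_translate (r := r) hLc1 cE cVH cΛ cE₂ cB Tc hBt l κ u κ' u' t) ε κ u κ' u' t
  -- the relative source's one-step DRIFT: source half ((F4b).2 at `(l, 1)` ⨾ §0) + the cells' drift (displayed), merged at one geometric rate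
  have hCcd : 0 ≤ Ccd := by simpa using (hcelld 0).nonneg
  have hbd : ∀ l, LocStencil₂
      ((((1 : ℝ) / 2) • ((fun κ u κ' u' => (cE₂ * (Lc : ℝ) ^ (2 * (3 + 1))) • mmRead Lc (K3OfK (unitK (sfStep Lc (l + 1)) (smStep 3 Lc (l + 1)) (coDressKBmAt (toSite r) Lc (KInvStep (d := 3) Lc (l +
        1)))) Lc (unitS (sfStep Lc (l + 1)) (smStep 3 Lc (l + 1)) (SpureRecAt 3 Lc (toSite r) cE cVH cΛ (l + 1))) (unitM (sfStep Lc (l + 1)) (smStep 3 Lc (l + 1)) (M1At 3 Lc (toSite r) cΛ (l +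
        1))) (W2SymOfK (unitK (sfStep Lc (l + 1)) (smStep 3 Lc (l + 1)) (coDressKBmAt (toSite r) Lc (KInvStep (d := 3) Lc (l + 1)))) Lc (unitS (sfStep Lc (l + 1)) (smStep 3 Lc (l + 1))
        (SpureRecAt 3 Lc (toSite r) cE cVH cΛ (l + 1))) (unitM (sfStep Lc (l + 1)) (smStep 3 Lc (l + 1)) (M1At 3 Lc (toSite r) cΛ (l + 1))) 0 (unitM₂ (sfStep Lc (l + 1)) (smStep 3 Lc (l + 1))
        (M2Of 3 Lc (mixFFAt (toSite r) Lc) (l + 1)))) κ u κ' u') + cB • vh₂S κ u κ' u') + ε • fun κ u κ' u' => sgnK (trK ((cE₂ * (Lc : ℝ) ^ (2 * (3 + 1))) • mmRead Lc (K3OfK (unitK (sfStep Lc (l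
        + 1)) (smStep 3 Lc (l + 1)) (coDressKBmAt (toSite r) Lc (KInvStep (d := 3) Lc (l + 1)))) Lc (unitS (sfStep Lc (l + 1)) (smStep 3 Lc (l + 1)) (SpureRecAt 3 Lc (toSite r) cE cVH cΛ (l +
        1))) (unitM (sfStep Lc (l + 1)) (smStep 3 Lc (l + 1)) (M1At 3 Lc (toSite r) cΛ (l + 1))) (W2SymOfK (unitK (sfStep Lc (l + 1)) (smStep 3 Lc (l + 1)) (coDressKBmAt (toSite r) Lc (KInvStep
        (d := 3) Lc (l + 1)))) Lc (unitS (sfStep Lc (l + 1)) (smStep 3 Lc (l + 1)) (SpureRecAt 3 Lc (toSite r) cE cVH cΛ (l + 1))) (unitM (sfStep Lc (l + 1)) (smStep 3 Lc (l + 1)) (M1At 3 Lc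
        (toSite r) cΛ (l + 1))) 0 (unitM₂ (sfStep Lc (l + 1)) (smStep 3 Lc (l + 1)) (M2Of 3 Lc (mixFFAt (toSite r) Lc) (l + 1)))) κ u κ' u') + cB • vh₂S κ u κ' u'))) + (lin4 (cE₂ * (Lc : ℝ) ^ (2
        * (3 + 1))) (unitK (sfStep Lc (l + 1)) (smStep 3 Lc (l + 1)) (coDressKBmAt (toSite r) Lc (KInvStep (d := 3) Lc (l + 1)))) Lc (((1 : ℝ) / 2) • (unitS₂ (sfStep Lc (l + 1)) (smStep 3 Lc (l
        + 1)) (T2RecAt 3 Lc (toSite r) cE cVH cΛ cE₂ cB Tc vh₂S (mixFFAt (toSite r) Lc) (l + 1)) + ε • fun κ u κ' u' => sgnK (trK ((unitS₂ (sfStep Lc (l + 1)) (smStep 3 Lc (l + 1)) (T2RecAt 3 Lc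
        (toSite r) cE cVH cΛ cE₂ cB Tc vh₂S (mixFFAt (toSite r) Lc) (l + 1))) κ u κ' u')))) - lin4 (cE₂ * (Lc : ℝ) ^ (2 * (3 + 1))) (unitK (sfStep Lc (l + 1)) (smStep 3 Lc (l + 1)) (KInvStep (d
        := 3) Lc (l + 1))) Lc (((1 : ℝ) / 2) • (unitS₂ (sfStep Lc (l + 1)) (smStep 3 Lc (l + 1)) (T2RecAt 3 Lc (toSite r) cE cVH cΛ cE₂ cB Tc vh₂S (mixFFAt (toSite r) Lc) (l + 1)) + ε • fun κ u
        κ' u' => sgnK (trK ((unitS₂ (sfStep Lc (l + 1)) (smStep 3 Lc (l + 1)) (T2RecAt 3 Lc (toSite r) cE cVH cΛ cE₂ cB Tc vh₂S (mixFFAt (toSite r) Lc) (l + 1))) κ u κ' u')))))) -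
       (((1 : ℝ) / 2) • ((fun κ u κ' u' => (cE₂ * (Lc : ℝ) ^ (2 * (3 + 1))) • mmRead Lc (K3OfK (unitK (sfStep Lc l) (smStep 3 Lc l) (coDressKBmAt (toSite r) Lc (KInvStep (d := 3) Lc l))) Lc (unitS
        (sfStep Lc l) (smStep 3 Lc l) (SpureRecAt 3 Lc (toSite r) cE cVH cΛ l)) (unitM (sfStep Lc l) (smStep 3 Lc l) (M1At 3 Lc (toSite r) cΛ l)) (W2SymOfK (unitK (sfStep Lc l) (smStep 3 Lc l)
        (coDressKBmAt (toSite r) Lc (KInvStep (d := 3) Lc l))) Lc (unitS (sfStep Lc l) (smStep 3 Lc l) (SpureRecAt 3 Lc (toSite r) cE cVH cΛ l)) (unitM (sfStep Lc l) (smStep 3 Lc l) (M1At 3 Lc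
        (toSite r) cΛ l)) 0 (unitM₂ (sfStep Lc l) (smStep 3 Lc l) (M2Of 3 Lc (mixFFAt (toSite r) Lc) l))) κ u κ' u') + cB • vh₂S κ u κ' u') + ε • fun κ u κ' u' => sgnK (trK ((cE₂ * (Lc : ℝ) ^ (2
        * (3 + 1))) • mmRead Lc (K3OfK (unitK (sfStep Lc l) (smStep 3 Lc l) (coDressKBmAt (toSite r) Lc (KInvStep (d := 3) Lc l))) Lc (unitS (sfStep Lc l) (smStep 3 Lc l) (SpureRecAt 3 Lc
        (toSite r) cE cVH cΛ l)) (unitM (sfStep Lc l) (smStep 3 Lc l) (M1At 3 Lc (toSite r) cΛ l)) (W2SymOfK (unitK (sfStep Lc l) (smStep 3 Lc l) (coDressKBmAt (toSite r) Lc (KInvStep (d := 3)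
        Lc l))) Lc (unitS (sfStep Lc l) (smStep 3 Lc l) (SpureRecAt 3 Lc (toSite r) cE cVH cΛ l)) (unitM (sfStep Lc l) (smStep 3 Lc l) (M1At 3 Lc (toSite r) cΛ l)) 0 (unitM₂ (sfStep Lc l)
        (smStep 3 Lc l) (M2Of 3 Lc (mixFFAt (toSite r) Lc) l))) κ u κ' u') + cB • vh₂S κ u κ' u'))) + (lin4 (cE₂ * (Lc : ℝ) ^ (2 * (3 + 1))) (unitK (sfStep Lc l) (smStep 3 Lc l) (coDressKBmAt
        (toSite r) Lc (KInvStep (d := 3) Lc l))) Lc (((1 : ℝ) / 2) • (unitS₂ (sfStep Lc l) (smStep 3 Lc l) (T2RecAt 3 Lc (toSite r) cE cVH cΛ cE₂ cB Tc vh₂S (mixFFAt (toSite r) Lc) l) + ε • fun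
        κ u κ' u' => sgnK (trK ((unitS₂ (sfStep Lc l) (smStep 3 Lc l) (T2RecAt 3 Lc (toSite r) cE cVH cΛ cE₂ cB Tc vh₂S (mixFFAt (toSite r) Lc) l)) κ u κ' u')))) - lin4 (cE₂ * (Lc : ℝ) ^ (2 * (3
        + 1))) (unitK (sfStep Lc l) (smStep 3 Lc l) (KInvStep (d := 3) Lc l)) Lc (((1 : ℝ) / 2) • (unitS₂ (sfStep Lc l) (smStep 3 Lc l) (T2RecAt 3 Lc (toSite r) cE cVH cΛ cE₂ cB Tc vh₂S (mixFFAt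
        (toSite r) Lc) l) + ε • fun κ u κ' u' => sgnK (trK ((unitS₂ (sfStep Lc l) (smStep 3 Lc l) (T2RecAt 3 Lc (toSite r) cE cVH cΛ cE₂ cB Tc vh₂S (mixFFAt (toSite r) Lc) l)) κ u κ' u'))))))) ((cb + Ccd) * max θb θc ^ l) (min δb' δcd) := fun l => by
    have h := locStencil₂_sub_add_sub
      (locStencil₂_le_mono (locStencil₂_halfTable_sub (hbdS l 1) hε) (mul_pow_le_mul_pow hcb hθb0 (le_max_left θb θc) l) (min_le_left δb' δcd))
      (locStencil₂_le_mono (hcelld l) (mul_pow_le_mul_pow hCcd hθc0 (le_max_right θb θc) l) (min_le_right δb' δcd))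
    rw [← add_mul] at h
    exact h
  exact rate_halfMember_three_of_relSource_rows hLc hr cE cVH cΛ cE₂ cB hpinEq Tc hBff hBmm hB hδB hBt ε hy hδy
    (fun l => locStencil₂_add ((locStencil₂_halfTable (hbt l) hε).mono (min_le_left _ _)) ((hcell l).mono (min_le_right _ _))) hm
    (fun l => ⟨fun κ u κ' u' t => add_translate_pi (w := (Lc : ℤ) • t) (v := -((Lc : ℤ) • t))
        (fun κ u κ' u' => translate_halfTable
          (fun κ u κ' u' t => source_comb_dressed_translate hLc1 hr cE cVH cΛ cE₂ cB Tc hBff hBmm ⟨CB, δB, hδB, hB⟩ hBt l κ u κ' u' t) ε κ u κ' u' t)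
        (sub_translate_pi (w := (Lc : ℤ) • t) (v := -((Lc : ℤ) • t))
          (fun κ u κ' u' => lin4_dressed_translate (toSite r) l _ (hY l) κ u κ' u' ((Lc : ℤ) • t))
          (fun κ u κ' u' => lin4_translate (shiftK_unitKInvStep (d := 3) (Lc := Lc) l) _ (hY l) κ u κ' u' ((Lc : ℤ) • t)))
        κ u κ' u', hC l⟩)
    hbd (hθb0.trans (le_max_left _ _)) (max_lt hθb1 hθc1) (lt_min hδb' hδcd)

/-- NOT IN PRINT; OUR BOOKKEEPING.  **«T2Drift^{ev}»**: §1 at `ε = 1`, spelled without the unit scalar (`½ • (T̃_n + P T̃_n)`; `one_smul`).  DISPLAYED: `hcell`, `hcelld`,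
`hC` as in §1 (at `ε = 1`). -/
theorem t2DriftEven_three_of_rows (hLc : 2 ≤ Lc) (hr : r ∈ box (3 + 1) Lc) (cE cVH cΛ cE₂ cB : ℝ)
    (hpinEq : cE₂ = (Lc : ℝ) ^ (2 * (3 + 1))) (Tc : Fin 4 → Fin 4 → Fin 4 → Fin 4 → ℝ)
    {vh₂S : Fin (3 + 1) → (Fin (3 + 1) → ℤ) → Fin (3 + 1) → (Fin (3 + 1) → ℤ) → MKer (3 + 1) (Fib 3)}
    (hBff : ∀ κ u κ' u' x z (α β : Fin (3 + 1)), vh₂S κ u κ' u' x z (Sum.inl α) (Sum.inl β) = 0)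
    (hBmm : ∀ κ u κ' u' x z (μ ν : Fin (3 + 1)), vh₂S κ u κ' u' x z (Sum.inr μ) (Sum.inr ν) = 0)
    {CB δB : ℝ} (hB : LocStencil₂ vh₂S CB δB) (hδB : 0 < δB)
    (hBt : ∀ (κ : Fin (3 + 1)) (u : Fin (3 + 1) → ℤ) (κ' : Fin (3 + 1)) (u' t : Fin (3 + 1) → ℤ),
        vh₂S κ (u + (Lc : ℤ) • t) κ' (u' + (Lc : ℤ) • t) = shiftK (-((Lc : ℤ) • t)) (vh₂S κ u κ' u'))
    {Cs cS θS δS : ℝ} (hS : ∀ j, LocStencil (unitS (sfStep Lc j) (smStep 3 Lc j) (SrecAt 3 Lc (toSite r) cE cVH cΛ j)) Cs δS)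
    (hSall : ∀ k j, LocStencil (unitS (sfStep Lc (k + j)) (smStep 3 Lc (k + j)) (SrecAt 3 Lc (toSite r) cE cVH cΛ (k + j)) -
      unitS (sfStep Lc k) (smStep 3 Lc k) (SrecAt 3 Lc (toSite r) cE cVH cΛ k)) (cS * θS ^ k) δS)
    (hδS : 0 < δS) (hθS0 : 0 ≤ θS) (hθS1 : θS < 1)
    {Ccl δcl : ℝ}
    (hcell : ∀ l, LocStencil₂
      (lin4 (cE₂ * (Lc : ℝ) ^ (2 * (3 + 1))) (unitK (sfStep Lc l) (smStep 3 Lc l) (coDressKBmAt (toSite r) Lc (KInvStep (d := 3) Lc l))) Lc (((1 : ℝ) / 2) • (unitS₂ (sfStep Lc l) (smStep 3 Lc l)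
        (T2RecAt 3 Lc (toSite r) cE cVH cΛ cE₂ cB Tc vh₂S (mixFFAt (toSite r) Lc) l) + fun κ u κ' u' => sgnK (trK ((unitS₂ (sfStep Lc l) (smStep 3 Lc l) (T2RecAt 3 Lc (toSite r) cE cVH cΛ cE₂ cB
        Tc vh₂S (mixFFAt (toSite r) Lc) l)) κ u κ' u')))) - lin4 (cE₂ * (Lc : ℝ) ^ (2 * (3 + 1))) (unitK (sfStep Lc l) (smStep 3 Lc l) (KInvStep (d := 3) Lc l)) Lc (((1 : ℝ) / 2) • (unitS₂
        (sfStep Lc l) (smStep 3 Lc l) (T2RecAt 3 Lc (toSite r) cE cVH cΛ cE₂ cB Tc vh₂S (mixFFAt (toSite r) Lc) l) + fun κ u κ' u' => sgnK (trK ((unitS₂ (sfStep Lc l) (smStep 3 Lc l) (T2RecAt 3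
        Lc (toSite r) cE cVH cΛ cE₂ cB Tc vh₂S (mixFFAt (toSite r) Lc) l)) κ u κ' u'))))) Ccl δcl)
    (hδcl : 0 < δcl) {Ccd θc δcd : ℝ}
    (hcelld : ∀ l, LocStencil₂
      ((lin4 (cE₂ * (Lc : ℝ) ^ (2 * (3 + 1))) (unitK (sfStep Lc (l + 1)) (smStep 3 Lc (l + 1)) (coDressKBmAt (toSite r) Lc (KInvStep (d := 3) Lc (l + 1)))) Lc (((1 : ℝ) / 2) • (unitS₂ (sfStep Lc (l +
        1)) (smStep 3 Lc (l + 1)) (T2RecAt 3 Lc (toSite r) cE cVH cΛ cE₂ cB Tc vh₂S (mixFFAt (toSite r) Lc) (l + 1)) + fun κ u κ' u' => sgnK (trK ((unitS₂ (sfStep Lc (l + 1)) (smStep 3 Lc (l +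
        1)) (T2RecAt 3 Lc (toSite r) cE cVH cΛ cE₂ cB Tc vh₂S (mixFFAt (toSite r) Lc) (l + 1))) κ u κ' u')))) - lin4 (cE₂ * (Lc : ℝ) ^ (2 * (3 + 1))) (unitK (sfStep Lc (l + 1)) (smStep 3 Lc (l +
        1)) (KInvStep (d := 3) Lc (l + 1))) Lc (((1 : ℝ) / 2) • (unitS₂ (sfStep Lc (l + 1)) (smStep 3 Lc (l + 1)) (T2RecAt 3 Lc (toSite r) cE cVH cΛ cE₂ cB Tc vh₂S (mixFFAt (toSite r) Lc) (l +
        1)) + fun κ u κ' u' => sgnK (trK ((unitS₂ (sfStep Lc (l + 1)) (smStep 3 Lc (l + 1)) (T2RecAt 3 Lc (toSite r) cE cVH cΛ cE₂ cB Tc vh₂S (mixFFAt (toSite r) Lc) (l + 1))) κ u κ' u'))))) -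
       (lin4 (cE₂ * (Lc : ℝ) ^ (2 * (3 + 1))) (unitK (sfStep Lc l) (smStep 3 Lc l) (coDressKBmAt (toSite r) Lc (KInvStep (d := 3) Lc l))) Lc (((1 : ℝ) / 2) • (unitS₂ (sfStep Lc l) (smStep 3 Lc l)
        (T2RecAt 3 Lc (toSite r) cE cVH cΛ cE₂ cB Tc vh₂S (mixFFAt (toSite r) Lc) l) + fun κ u κ' u' => sgnK (trK ((unitS₂ (sfStep Lc l) (smStep 3 Lc l) (T2RecAt 3 Lc (toSite r) cE cVH cΛ cE₂ cB
        Tc vh₂S (mixFFAt (toSite r) Lc) l)) κ u κ' u')))) - lin4 (cE₂ * (Lc : ℝ) ^ (2 * (3 + 1))) (unitK (sfStep Lc l) (smStep 3 Lc l) (KInvStep (d := 3) Lc l)) Lc (((1 : ℝ) / 2) • (unitS₂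
        (sfStep Lc l) (smStep 3 Lc l) (T2RecAt 3 Lc (toSite r) cE cVH cΛ cE₂ cB Tc vh₂S (mixFFAt (toSite r) Lc) l) + fun κ u κ' u' => sgnK (trK ((unitS₂ (sfStep Lc l) (smStep 3 Lc l) (T2RecAt 3
        Lc (toSite r) cE cVH cΛ cE₂ cB Tc vh₂S (mixFFAt (toSite r) Lc) l)) κ u κ' u')))))) (Ccd * θc ^ l) δcd)
    (hθc0 : 0 ≤ θc) (hθc1 : θc < 1) (hδcd : 0 < δcd)
    (hC : ∀ l, (∀ κ κ' κ₁ κ₂, zmode Lc (((1 : ℝ) / 2) • ((fun κ u κ' u' => (cE₂ * (Lc : ℝ) ^ (2 * (3 + 1))) • mmRead Lc (K3OfK (unitK (sfStep Lc l) (smStep 3 Lc l) (coDressKBmAt (toSite r) Lc (KInvStep (d :=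
        3) Lc l))) Lc (unitS (sfStep Lc l) (smStep 3 Lc l) (SpureRecAt 3 Lc (toSite r) cE cVH cΛ l)) (unitM (sfStep Lc l) (smStep 3 Lc l) (M1At 3 Lc (toSite r) cΛ l)) (W2SymOfK (unitK (sfStep Lc
        l) (smStep 3 Lc l) (coDressKBmAt (toSite r) Lc (KInvStep (d := 3) Lc l))) Lc (unitS (sfStep Lc l) (smStep 3 Lc l) (SpureRecAt 3 Lc (toSite r) cE cVH cΛ l)) (unitM (sfStep Lc l) (smStep 3
        Lc l) (M1At 3 Lc (toSite r) cΛ l)) 0 (unitM₂ (sfStep Lc l) (smStep 3 Lc l) (M2Of 3 Lc (mixFFAt (toSite r) Lc) l))) κ u κ' u') + cB • vh₂S κ u κ' u') + fun κ u κ' u' => sgnK (trK ((cE₂ *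
        (Lc : ℝ) ^ (2 * (3 + 1))) • mmRead Lc (K3OfK (unitK (sfStep Lc l) (smStep 3 Lc l) (coDressKBmAt (toSite r) Lc (KInvStep (d := 3) Lc l))) Lc (unitS (sfStep Lc l) (smStep 3 Lc l)
        (SpureRecAt 3 Lc (toSite r) cE cVH cΛ l)) (unitM (sfStep Lc l) (smStep 3 Lc l) (M1At 3 Lc (toSite r) cΛ l)) (W2SymOfK (unitK (sfStep Lc l) (smStep 3 Lc l) (coDressKBmAt (toSite r) Lc
        (KInvStep (d := 3) Lc l))) Lc (unitS (sfStep Lc l) (smStep 3 Lc l) (SpureRecAt 3 Lc (toSite r) cE cVH cΛ l)) (unitM (sfStep Lc l) (smStep 3 Lc l) (M1At 3 Lc (toSite r) cΛ l)) 0 (unitM₂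
        (sfStep Lc l) (smStep 3 Lc l) (M2Of 3 Lc (mixFFAt (toSite r) Lc) l))) κ u κ' u') + cB • vh₂S κ u κ' u'))) + (lin4 (cE₂ * (Lc : ℝ) ^ (2 * (3 + 1))) (unitK (sfStep Lc l) (smStep 3 Lc l)
        (coDressKBmAt (toSite r) Lc (KInvStep (d := 3) Lc l))) Lc (((1 : ℝ) / 2) • (unitS₂ (sfStep Lc l) (smStep 3 Lc l) (T2RecAt 3 Lc (toSite r) cE cVH cΛ cE₂ cB Tc vh₂S (mixFFAt (toSite r) Lc)
        l) + fun κ u κ' u' => sgnK (trK ((unitS₂ (sfStep Lc l) (smStep 3 Lc l) (T2RecAt 3 Lc (toSite r) cE cVH cΛ cE₂ cB Tc vh₂S (mixFFAt (toSite r) Lc) l)) κ u κ' u')))) - lin4 (cE₂ * (Lc : ℝ)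
        ^ (2 * (3 + 1))) (unitK (sfStep Lc l) (smStep 3 Lc l) (KInvStep (d := 3) Lc l)) Lc (((1 : ℝ) / 2) • (unitS₂ (sfStep Lc l) (smStep 3 Lc l) (T2RecAt 3 Lc (toSite r) cE cVH cΛ cE₂ cB Tc
        vh₂S (mixFFAt (toSite r) Lc) l) + fun κ u κ' u' => sgnK (trK ((unitS₂ (sfStep Lc l) (smStep 3 Lc l) (T2RecAt 3 Lc (toSite r) cE cVH cΛ cE₂ cB Tc vh₂S (mixFFAt (toSite r) Lc) l)) κ u κ'
        u')))))) κ κ' (Sum.inl κ₁) (Sum.inl κ₂) + zmode Lc (((1 : ℝ) / 2) • ((fun κ u κ' u' => (cE₂ * (Lc : ℝ) ^ (2 * (3 + 1))) • mmRead Lc (K3OfK (unitK (sfStep Lc l) (smStep 3 Lc l)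
        (coDressKBmAt (toSite r) Lc (KInvStep (d := 3) Lc l))) Lc (unitS (sfStep Lc l) (smStep 3 Lc l) (SpureRecAt 3 Lc (toSite r) cE cVH cΛ l)) (unitM (sfStep Lc l) (smStep 3 Lc l) (M1At 3 Lc
        (toSite r) cΛ l)) (W2SymOfK (unitK (sfStep Lc l) (smStep 3 Lc l) (coDressKBmAt (toSite r) Lc (KInvStep (d := 3) Lc l))) Lc (unitS (sfStep Lc l) (smStep 3 Lc l) (SpureRecAt 3 Lc (toSite
        r) cE cVH cΛ l)) (unitM (sfStep Lc l) (smStep 3 Lc l) (M1At 3 Lc (toSite r) cΛ l)) 0 (unitM₂ (sfStep Lc l) (smStep 3 Lc l) (M2Of 3 Lc (mixFFAt (toSite r) Lc) l))) κ u κ' u') + cB • vh₂S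
        κ u κ' u') + fun κ u κ' u' => sgnK (trK ((cE₂ * (Lc : ℝ) ^ (2 * (3 + 1))) • mmRead Lc (K3OfK (unitK (sfStep Lc l) (smStep 3 Lc l) (coDressKBmAt (toSite r) Lc (KInvStep (d := 3) Lc l)))
        Lc (unitS (sfStep Lc l) (smStep 3 Lc l) (SpureRecAt 3 Lc (toSite r) cE cVH cΛ l)) (unitM (sfStep Lc l) (smStep 3 Lc l) (M1At 3 Lc (toSite r) cΛ l)) (W2SymOfK (unitK (sfStep Lc l) (smStep
        3 Lc l) (coDressKBmAt (toSite r) Lc (KInvStep (d := 3) Lc l))) Lc (unitS (sfStep Lc l) (smStep 3 Lc l) (SpureRecAt 3 Lc (toSite r) cE cVH cΛ l)) (unitM (sfStep Lc l) (smStep 3 Lc l)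
        (M1At 3 Lc (toSite r) cΛ l)) 0 (unitM₂ (sfStep Lc l) (smStep 3 Lc l) (M2Of 3 Lc (mixFFAt (toSite r) Lc) l))) κ u κ' u') + cB • vh₂S κ u κ' u'))) + (lin4 (cE₂ * (Lc : ℝ) ^ (2 * (3 + 1)))
        (unitK (sfStep Lc l) (smStep 3 Lc l) (coDressKBmAt (toSite r) Lc (KInvStep (d := 3) Lc l))) Lc (((1 : ℝ) / 2) • (unitS₂ (sfStep Lc l) (smStep 3 Lc l) (T2RecAt 3 Lc (toSite r) cE cVH cΛ
        cE₂ cB Tc vh₂S (mixFFAt (toSite r) Lc) l) + fun κ u κ' u' => sgnK (trK ((unitS₂ (sfStep Lc l) (smStep 3 Lc l) (T2RecAt 3 Lc (toSite r) cE cVH cΛ cE₂ cB Tc vh₂S (mixFFAt (toSite r) Lc)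
        l)) κ u κ' u')))) - lin4 (cE₂ * (Lc : ℝ) ^ (2 * (3 + 1))) (unitK (sfStep Lc l) (smStep 3 Lc l) (KInvStep (d := 3) Lc l)) Lc (((1 : ℝ) / 2) • (unitS₂ (sfStep Lc l) (smStep 3 Lc l)
        (T2RecAt 3 Lc (toSite r) cE cVH cΛ cE₂ cB Tc vh₂S (mixFFAt (toSite r) Lc) l) + fun κ u κ' u' => sgnK (trK ((unitS₂ (sfStep Lc l) (smStep 3 Lc l) (T2RecAt 3 Lc (toSite r) cE cVH cΛ cE₂ cB
        Tc vh₂S (mixFFAt (toSite r) Lc) l)) κ u κ' u')))))) κ' κ (Sum.inl κ₁) (Sum.inl κ₂) = 0)) :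
    ∃ c ϑ δ : ℝ, 0 ≤ c ∧ 0 < ϑ ∧ ϑ < 1 ∧ 0 < δ ∧
      (∀ n, LocStencil₂
        ((((1 : ℝ) / 2) • (unitS₂ (sfStep Lc (n + 1)) (smStep 3 Lc (n + 1)) (T2RecAt 3 Lc (toSite r) cE cVH cΛ cE₂ cB Tc vh₂S (mixFFAt (toSite r) Lc) (n + 1)) + fun κ u κ' u' => sgnK (trK ((unitS₂
          (sfStep Lc (n + 1)) (smStep 3 Lc (n + 1)) (T2RecAt 3 Lc (toSite r) cE cVH cΛ cE₂ cB Tc vh₂S (mixFFAt (toSite r) Lc) (n + 1))) κ u κ' u')))) -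
         (((1 : ℝ) / 2) • (unitS₂ (sfStep Lc n) (smStep 3 Lc n) (T2RecAt 3 Lc (toSite r) cE cVH cΛ cE₂ cB Tc vh₂S (mixFFAt (toSite r) Lc) n) + fun κ u κ' u' => sgnK (trK ((unitS₂ (sfStep Lc n) (smStep 3
          Lc n) (T2RecAt 3 Lc (toSite r) cE cVH cΛ cE₂ cB Tc vh₂S (mixFFAt (toSite r) Lc) n)) κ u κ' u'))))) (c * ϑ ^ n) δ) ∧
      (∀ k j, LocStencil₂
        ((((1 : ℝ) / 2) • (unitS₂ (sfStep Lc (k + j)) (smStep 3 Lc (k + j)) (T2RecAt 3 Lc (toSite r) cE cVH cΛ cE₂ cB Tc vh₂S (mixFFAt (toSite r) Lc) (k + j)) + fun κ u κ' u' => sgnK (trK ((unitS₂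
          (sfStep Lc (k + j)) (smStep 3 Lc (k + j)) (T2RecAt 3 Lc (toSite r) cE cVH cΛ cE₂ cB Tc vh₂S (mixFFAt (toSite r) Lc) (k + j))) κ u κ' u')))) -
         (((1 : ℝ) / 2) • (unitS₂ (sfStep Lc k) (smStep 3 Lc k) (T2RecAt 3 Lc (toSite r) cE cVH cΛ cE₂ cB Tc vh₂S (mixFFAt (toSite r) Lc) k) + fun κ u κ' u' => sgnK (trK ((unitS₂ (sfStep Lc k) (smStep 3
          Lc k) (T2RecAt 3 Lc (toSite r) cE cVH cΛ cE₂ cB Tc vh₂S (mixFFAt (toSite r) Lc) k)) κ u κ' u'))))) (c * (1 - ϑ)⁻¹ * ϑ ^ k) δ) := by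
  have h := rate_halfMember_three_of_rows hLc hr cE cVH cΛ cE₂ cB hpinEq Tc hBff hBmm hB hδB hBt hS hSall hδS hθS0 hθS1 1 (by norm_num)
    (Ccl := Ccl) (δcl := δcl) (by simpa only [one_smul] using hcell) hδcl (Ccd := Ccd) (θc := θc) (δcd := δcd)
    (by simpa only [one_smul] using hcelld) hθc0 hθc1 hδcd (by simpa only [one_smul] using hC)
  simpa only [one_smul] using h

/-! ## §2 The JOINT PAIR («T2Shape^{ev}», «T2Drift^{ev}») at one rate — p2 g45's `hT₂ ∕ hT₂d` binders token for token -/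

/-- NOT IN PRINT; OUR BOOKKEEPING ([folklore] MY `T2ShapeEvenEndRows.t2ShapeEven_three_of_rows` ∧ §1 `t2DriftEven_three_of_rows`, `min` of the two rates).  **THE TWO
EVEN-MEMBER T₂ ROWS OF p2 g45's `WrecAtEvenHalfRowsFinal` AT ONE RATE, FROM THE S-SLOT ROWS ∧ THE BORDER ROWS ∧ `hcell` ∧ `hcelld` ∧ `hC`** (`d = 3`, `2 ≤ Lc`,
in-block root, EXACT pin): `∃ C₂ c₂ θ₂ δ₂, 0 < δ₂ ∧ 0 ≤ θ₂ ∧ θ₂ < 1 ∧ (∀ j, LocStencil₂ (y_j) C₂ δ₂) ∧ (∀ k j, LocStencil₂ (y_{k+j} − y_k) (c₂·θ₂^k) δ₂)`, `y_j = ½ • (T̃_j +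
P T̃_j)`.  CONDITIONAL on the three displayed rows; NOT «W-slot closed»; NEVER «G-an2-4 closed» as (CONV-C); NOT D1, NOT `BetaPertH`, NOT continuum, NOT Clay. -/
theorem exists_hT₂_hT₂d_even_three_of_rows (hLc : 2 ≤ Lc) (hr : r ∈ box (3 + 1) Lc) (cE cVH cΛ cE₂ cB : ℝ)
    (hpinEq : cE₂ = (Lc : ℝ) ^ (2 * (3 + 1))) (Tc : Fin 4 → Fin 4 → Fin 4 → Fin 4 → ℝ)
    {vh₂S : Fin (3 + 1) → (Fin (3 + 1) → ℤ) → Fin (3 + 1) → (Fin (3 + 1) → ℤ) → MKer (3 + 1) (Fib 3)}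
    (hBff : ∀ κ u κ' u' x z (α β : Fin (3 + 1)), vh₂S κ u κ' u' x z (Sum.inl α) (Sum.inl β) = 0)
    (hBmm : ∀ κ u κ' u' x z (μ ν : Fin (3 + 1)), vh₂S κ u κ' u' x z (Sum.inr μ) (Sum.inr ν) = 0)
    {CB δB : ℝ} (hB : LocStencil₂ vh₂S CB δB) (hδB : 0 < δB)
    (hBt : ∀ (κ : Fin (3 + 1)) (u : Fin (3 + 1) → ℤ) (κ' : Fin (3 + 1)) (u' t : Fin (3 + 1) → ℤ),
        vh₂S κ (u + (Lc : ℤ) • t) κ' (u' + (Lc : ℤ) • t) = shiftK (-((Lc : ℤ) • t)) (vh₂S κ u κ' u'))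
    {Cs cS θS δS : ℝ} (hS : ∀ j, LocStencil (unitS (sfStep Lc j) (smStep 3 Lc j) (SrecAt 3 Lc (toSite r) cE cVH cΛ j)) Cs δS)
    (hSall : ∀ k j, LocStencil (unitS (sfStep Lc (k + j)) (smStep 3 Lc (k + j)) (SrecAt 3 Lc (toSite r) cE cVH cΛ (k + j)) -
      unitS (sfStep Lc k) (smStep 3 Lc k) (SrecAt 3 Lc (toSite r) cE cVH cΛ k)) (cS * θS ^ k) δS)
    (hδS : 0 < δS) (hθS0 : 0 ≤ θS) (hθS1 : θS < 1)
    {Ccl δcl : ℝ}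
    (hcell : ∀ l, LocStencil₂
      (lin4 (cE₂ * (Lc : ℝ) ^ (2 * (3 + 1))) (unitK (sfStep Lc l) (smStep 3 Lc l) (coDressKBmAt (toSite r) Lc (KInvStep (d := 3) Lc l))) Lc (((1 : ℝ) / 2) • (unitS₂ (sfStep Lc l) (smStep 3 Lc l)
        (T2RecAt 3 Lc (toSite r) cE cVH cΛ cE₂ cB Tc vh₂S (mixFFAt (toSite r) Lc) l) + fun κ u κ' u' => sgnK (trK ((unitS₂ (sfStep Lc l) (smStep 3 Lc l) (T2RecAt 3 Lc (toSite r) cE cVH cΛ cE₂ cB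
        Tc vh₂S (mixFFAt (toSite r) Lc) l)) κ u κ' u')))) - lin4 (cE₂ * (Lc : ℝ) ^ (2 * (3 + 1))) (unitK (sfStep Lc l) (smStep 3 Lc l) (KInvStep (d := 3) Lc l)) Lc (((1 : ℝ) / 2) • (unitS₂
        (sfStep Lc l) (smStep 3 Lc l) (T2RecAt 3 Lc (toSite r) cE cVH cΛ cE₂ cB Tc vh₂S (mixFFAt (toSite r) Lc) l) + fun κ u κ' u' => sgnK (trK ((unitS₂ (sfStep Lc l) (smStep 3 Lc l) (T2RecAt 3
        Lc (toSite r) cE cVH cΛ cE₂ cB Tc vh₂S (mixFFAt (toSite r) Lc) l)) κ u κ' u'))))) Ccl δcl)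
    (hδcl : 0 < δcl) {Ccd θc δcd : ℝ}
    (hcelld : ∀ l, LocStencil₂
      ((lin4 (cE₂ * (Lc : ℝ) ^ (2 * (3 + 1))) (unitK (sfStep Lc (l + 1)) (smStep 3 Lc (l + 1)) (coDressKBmAt (toSite r) Lc (KInvStep (d := 3) Lc (l + 1)))) Lc (((1 : ℝ) / 2) • (unitS₂ (sfStep Lc (l +
        1)) (smStep 3 Lc (l + 1)) (T2RecAt 3 Lc (toSite r) cE cVH cΛ cE₂ cB Tc vh₂S (mixFFAt (toSite r) Lc) (l + 1)) + fun κ u κ' u' => sgnK (trK ((unitS₂ (sfStep Lc (l + 1)) (smStep 3 Lc (l +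
        1)) (T2RecAt 3 Lc (toSite r) cE cVH cΛ cE₂ cB Tc vh₂S (mixFFAt (toSite r) Lc) (l + 1))) κ u κ' u')))) - lin4 (cE₂ * (Lc : ℝ) ^ (2 * (3 + 1))) (unitK (sfStep Lc (l + 1)) (smStep 3 Lc (l +
        1)) (KInvStep (d := 3) Lc (l + 1))) Lc (((1 : ℝ) / 2) • (unitS₂ (sfStep Lc (l + 1)) (smStep 3 Lc (l + 1)) (T2RecAt 3 Lc (toSite r) cE cVH cΛ cE₂ cB Tc vh₂S (mixFFAt (toSite r) Lc) (l +
        1)) + fun κ u κ' u' => sgnK (trK ((unitS₂ (sfStep Lc (l + 1)) (smStep 3 Lc (l + 1)) (T2RecAt 3 Lc (toSite r) cE cVH cΛ cE₂ cB Tc vh₂S (mixFFAt (toSite r) Lc) (l + 1))) κ u κ' u'))))) -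
       (lin4 (cE₂ * (Lc : ℝ) ^ (2 * (3 + 1))) (unitK (sfStep Lc l) (smStep 3 Lc l) (coDressKBmAt (toSite r) Lc (KInvStep (d := 3) Lc l))) Lc (((1 : ℝ) / 2) • (unitS₂ (sfStep Lc l) (smStep 3 Lc l)
        (T2RecAt 3 Lc (toSite r) cE cVH cΛ cE₂ cB Tc vh₂S (mixFFAt (toSite r) Lc) l) + fun κ u κ' u' => sgnK (trK ((unitS₂ (sfStep Lc l) (smStep 3 Lc l) (T2RecAt 3 Lc (toSite r) cE cVH cΛ cE₂ cB
        Tc vh₂S (mixFFAt (toSite r) Lc) l)) κ u κ' u')))) - lin4 (cE₂ * (Lc : ℝ) ^ (2 * (3 + 1))) (unitK (sfStep Lc l) (smStep 3 Lc l) (KInvStep (d := 3) Lc l)) Lc (((1 : ℝ) / 2) • (unitS₂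
        (sfStep Lc l) (smStep 3 Lc l) (T2RecAt 3 Lc (toSite r) cE cVH cΛ cE₂ cB Tc vh₂S (mixFFAt (toSite r) Lc) l) + fun κ u κ' u' => sgnK (trK ((unitS₂ (sfStep Lc l) (smStep 3 Lc l) (T2RecAt 3
        Lc (toSite r) cE cVH cΛ cE₂ cB Tc vh₂S (mixFFAt (toSite r) Lc) l)) κ u κ' u')))))) (Ccd * θc ^ l) δcd)
    (hθc0 : 0 ≤ θc) (hθc1 : θc < 1) (hδcd : 0 < δcd)
    (hC : ∀ l, (∀ κ κ' κ₁ κ₂, zmode Lc (((1 : ℝ) / 2) • ((fun κ u κ' u' => (cE₂ * (Lc : ℝ) ^ (2 * (3 + 1))) • mmRead Lc (K3OfK (unitK (sfStep Lc l) (smStep 3 Lc l) (coDressKBmAt (toSite r) Lc (KInvStep (d :=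
        3) Lc l))) Lc (unitS (sfStep Lc l) (smStep 3 Lc l) (SpureRecAt 3 Lc (toSite r) cE cVH cΛ l)) (unitM (sfStep Lc l) (smStep 3 Lc l) (M1At 3 Lc (toSite r) cΛ l)) (W2SymOfK (unitK (sfStep Lc
        l) (smStep 3 Lc l) (coDressKBmAt (toSite r) Lc (KInvStep (d := 3) Lc l))) Lc (unitS (sfStep Lc l) (smStep 3 Lc l) (SpureRecAt 3 Lc (toSite r) cE cVH cΛ l)) (unitM (sfStep Lc l) (smStep 3
        Lc l) (M1At 3 Lc (toSite r) cΛ l)) 0 (unitM₂ (sfStep Lc l) (smStep 3 Lc l) (M2Of 3 Lc (mixFFAt (toSite r) Lc) l))) κ u κ' u') + cB • vh₂S κ u κ' u') + fun κ u κ' u' => sgnK (trK ((cE₂ *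
        (Lc : ℝ) ^ (2 * (3 + 1))) • mmRead Lc (K3OfK (unitK (sfStep Lc l) (smStep 3 Lc l) (coDressKBmAt (toSite r) Lc (KInvStep (d := 3) Lc l))) Lc (unitS (sfStep Lc l) (smStep 3 Lc l)
        (SpureRecAt 3 Lc (toSite r) cE cVH cΛ l)) (unitM (sfStep Lc l) (smStep 3 Lc l) (M1At 3 Lc (toSite r) cΛ l)) (W2SymOfK (unitK (sfStep Lc l) (smStep 3 Lc l) (coDressKBmAt (toSite r) Lc
        (KInvStep (d := 3) Lc l))) Lc (unitS (sfStep Lc l) (smStep 3 Lc l) (SpureRecAt 3 Lc (toSite r) cE cVH cΛ l)) (unitM (sfStep Lc l) (smStep 3 Lc l) (M1At 3 Lc (toSite r) cΛ l)) 0 (unitM₂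
        (sfStep Lc l) (smStep 3 Lc l) (M2Of 3 Lc (mixFFAt (toSite r) Lc) l))) κ u κ' u') + cB • vh₂S κ u κ' u'))) + (lin4 (cE₂ * (Lc : ℝ) ^ (2 * (3 + 1))) (unitK (sfStep Lc l) (smStep 3 Lc l)
        (coDressKBmAt (toSite r) Lc (KInvStep (d := 3) Lc l))) Lc (((1 : ℝ) / 2) • (unitS₂ (sfStep Lc l) (smStep 3 Lc l) (T2RecAt 3 Lc (toSite r) cE cVH cΛ cE₂ cB Tc vh₂S (mixFFAt (toSite r) Lc)
        l) + fun κ u κ' u' => sgnK (trK ((unitS₂ (sfStep Lc l) (smStep 3 Lc l) (T2RecAt 3 Lc (toSite r) cE cVH cΛ cE₂ cB Tc vh₂S (mixFFAt (toSite r) Lc) l)) κ u κ' u')))) - lin4 (cE₂ * (Lc : ℝ)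
        ^ (2 * (3 + 1))) (unitK (sfStep Lc l) (smStep 3 Lc l) (KInvStep (d := 3) Lc l)) Lc (((1 : ℝ) / 2) • (unitS₂ (sfStep Lc l) (smStep 3 Lc l) (T2RecAt 3 Lc (toSite r) cE cVH cΛ cE₂ cB Tc
        vh₂S (mixFFAt (toSite r) Lc) l) + fun κ u κ' u' => sgnK (trK ((unitS₂ (sfStep Lc l) (smStep 3 Lc l) (T2RecAt 3 Lc (toSite r) cE cVH cΛ cE₂ cB Tc vh₂S (mixFFAt (toSite r) Lc) l)) κ u κ'
        u')))))) κ κ' (Sum.inl κ₁) (Sum.inl κ₂) + zmode Lc (((1 : ℝ) / 2) • ((fun κ u κ' u' => (cE₂ * (Lc : ℝ) ^ (2 * (3 + 1))) • mmRead Lc (K3OfK (unitK (sfStep Lc l) (smStep 3 Lc l)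
        (coDressKBmAt (toSite r) Lc (KInvStep (d := 3) Lc l))) Lc (unitS (sfStep Lc l) (smStep 3 Lc l) (SpureRecAt 3 Lc (toSite r) cE cVH cΛ l)) (unitM (sfStep Lc l) (smStep 3 Lc l) (M1At 3 Lc
        (toSite r) cΛ l)) (W2SymOfK (unitK (sfStep Lc l) (smStep 3 Lc l) (coDressKBmAt (toSite r) Lc (KInvStep (d := 3) Lc l))) Lc (unitS (sfStep Lc l) (smStep 3 Lc l) (SpureRecAt 3 Lc (toSite
        r) cE cVH cΛ l)) (unitM (sfStep Lc l) (smStep 3 Lc l) (M1At 3 Lc (toSite r) cΛ l)) 0 (unitM₂ (sfStep Lc l) (smStep 3 Lc l) (M2Of 3 Lc (mixFFAt (toSite r) Lc) l))) κ u κ' u') + cB • vh₂S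
        κ u κ' u') + fun κ u κ' u' => sgnK (trK ((cE₂ * (Lc : ℝ) ^ (2 * (3 + 1))) • mmRead Lc (K3OfK (unitK (sfStep Lc l) (smStep 3 Lc l) (coDressKBmAt (toSite r) Lc (KInvStep (d := 3) Lc l)))
        Lc (unitS (sfStep Lc l) (smStep 3 Lc l) (SpureRecAt 3 Lc (toSite r) cE cVH cΛ l)) (unitM (sfStep Lc l) (smStep 3 Lc l) (M1At 3 Lc (toSite r) cΛ l)) (W2SymOfK (unitK (sfStep Lc l) (smStep
        3 Lc l) (coDressKBmAt (toSite r) Lc (KInvStep (d := 3) Lc l))) Lc (unitS (sfStep Lc l) (smStep 3 Lc l) (SpureRecAt 3 Lc (toSite r) cE cVH cΛ l)) (unitM (sfStep Lc l) (smStep 3 Lc l)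
        (M1At 3 Lc (toSite r) cΛ l)) 0 (unitM₂ (sfStep Lc l) (smStep 3 Lc l) (M2Of 3 Lc (mixFFAt (toSite r) Lc) l))) κ u κ' u') + cB • vh₂S κ u κ' u'))) + (lin4 (cE₂ * (Lc : ℝ) ^ (2 * (3 + 1)))
        (unitK (sfStep Lc l) (smStep 3 Lc l) (coDressKBmAt (toSite r) Lc (KInvStep (d := 3) Lc l))) Lc (((1 : ℝ) / 2) • (unitS₂ (sfStep Lc l) (smStep 3 Lc l) (T2RecAt 3 Lc (toSite r) cE cVH cΛ
        cE₂ cB Tc vh₂S (mixFFAt (toSite r) Lc) l) + fun κ u κ' u' => sgnK (trK ((unitS₂ (sfStep Lc l) (smStep 3 Lc l) (T2RecAt 3 Lc (toSite r) cE cVH cΛ cE₂ cB Tc vh₂S (mixFFAt (toSite r) Lc)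
        l)) κ u κ' u')))) - lin4 (cE₂ * (Lc : ℝ) ^ (2 * (3 + 1))) (unitK (sfStep Lc l) (smStep 3 Lc l) (KInvStep (d := 3) Lc l)) Lc (((1 : ℝ) / 2) • (unitS₂ (sfStep Lc l) (smStep 3 Lc l)
        (T2RecAt 3 Lc (toSite r) cE cVH cΛ cE₂ cB Tc vh₂S (mixFFAt (toSite r) Lc) l) + fun κ u κ' u' => sgnK (trK ((unitS₂ (sfStep Lc l) (smStep 3 Lc l) (T2RecAt 3 Lc (toSite r) cE cVH cΛ cE₂ cB
        Tc vh₂S (mixFFAt (toSite r) Lc) l)) κ u κ' u')))))) κ' κ (Sum.inl κ₁) (Sum.inl κ₂) = 0)) :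
    ∃ C₂ c₂ θ₂ δ₂ : ℝ, 0 < δ₂ ∧ 0 ≤ θ₂ ∧ θ₂ < 1 ∧
      (∀ j, LocStencil₂ (((1 : ℝ) / 2) • (unitS₂ (sfStep Lc j) (smStep 3 Lc j) (T2RecAt 3 Lc (toSite r) cE cVH cΛ cE₂ cB Tc vh₂S (mixFFAt (toSite r) Lc) j) + fun κ u κ' u' => sgnK (trK ((unitS₂ (sfStep Lc j) (smStep 3
        Lc j) (T2RecAt 3 Lc (toSite r) cE cVH cΛ cE₂ cB Tc vh₂S (mixFFAt (toSite r) Lc) j)) κ u κ' u')))) C₂ δ₂) ∧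
      (∀ k j, LocStencil₂
        ((((1 : ℝ) / 2) • (unitS₂ (sfStep Lc (k + j)) (smStep 3 Lc (k + j)) (T2RecAt 3 Lc (toSite r) cE cVH cΛ cE₂ cB Tc vh₂S (mixFFAt (toSite r) Lc) (k + j)) + fun κ u κ' u' => sgnK (trK ((unitS₂
          (sfStep Lc (k + j)) (smStep 3 Lc (k + j)) (T2RecAt 3 Lc (toSite r) cE cVH cΛ cE₂ cB Tc vh₂S (mixFFAt (toSite r) Lc) (k + j))) κ u κ' u')))) -
         (((1 : ℝ) / 2) • (unitS₂ (sfStep Lc k) (smStep 3 Lc k) (T2RecAt 3 Lc (toSite r) cE cVH cΛ cE₂ cB Tc vh₂S (mixFFAt (toSite r) Lc) k) + fun κ u κ' u' => sgnK (trK ((unitS₂ (sfStep Lc k) (smStep 3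
          Lc k) (T2RecAt 3 Lc (toSite r) cE cVH cΛ cE₂ cB Tc vh₂S (mixFFAt (toSite r) Lc) k)) κ u κ' u'))))) (c₂ * θ₂ ^ k) δ₂) := by
  have hpin : |cE₂| ≤ (Lc : ℝ) ^ (2 * (3 + 1)) := by
    rw [hpinEq, abs_of_nonneg (by positivity)]
  obtain ⟨C, δ, hδ, hT⟩ := t2ShapeEven_three_of_rows hLc hr cE cVH cΛ cE₂ cB hpin Tc hBff hBmm hB hδB hBt hS hSall hδS hθS0 hθS1 hcell hδcl hC
  obtain ⟨c, ϑ, δ', hc, hϑ0, hϑ1, hδ', -, hCau⟩ := t2DriftEven_three_of_rows hLc hr cE cVH cΛ cE₂ cB hpinEq Tc hBff hBmm hB hδB hBt hS hSall hδS hθS0 hθS1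
    hcell hδcl hcelld hθc0 hθc1 hδcd hC
  exact ⟨C, c * (1 - ϑ)⁻¹, ϑ, min δ δ', lt_min hδ hδ', hϑ0.le, hϑ1, fun j => (hT j).mono (min_le_left _ _), fun k j => (hCau k j).mono (min_le_right _ _)⟩

end Three

end Summit.QuantumFields.BalabanUV.Beta.GAN24.T2DriftEvenEndRows

end
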